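import Summits.ValiantsHypothesis.ValiantsHypothesis.Theorems.LacunarySymmetroidMatrixDescartesCensusPivotTwoDescartes
import Summits.ValiantsHypothesis.ValiantsHypothesis.Theorems.LacunarySymmetroidMatrixDescartesCensusFullAlternation

/-!
# `MatrixDescartes` (stmt-ValiantsHypothesis-18050) — the `m = 2` pivot row on ARITHMETIC-PROGRESSION SUPPORTS:
# `Z₊ ≤ 2L` when the `K + 1` exponents lie in an AP window of `L + 1` terms (so `Z₊ ≤ 2K` when the support IS an AP)

HONEST FRAMING.  Cell `pub-symmetroid`, seat `val-sym-mdr-p1` (gen 10); helper `--supports` the crux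
`Theses.LacunarySymmetroid.MatrixDescartes` (OPEN, on HOLD), NO closure claim.  In conjb-1's pivot currency
(`…CensusPivotDefs`: `pivotPosRoots e d J P` = number of distinct positive zeros of `det (X^e • J + ∑ₖ X^{dₖ} • Pₖ)`,
`PivotRootLawAt m K q B`) the `m = 2` row is known to satisfy `Z₊ ≤ 2K + 2` always (R1₂, `…CensusPivotTwoDescartes`),
`Z₊ ≤ 2K` for `K ≤ 3` (`…PivotTwoThree`) and `Z₊ ≥ 2K` at `K = 4, 5, 6` (kernel witnesses); the conjectured value is `2K`.
This file proves the cheapest SECTOR of the conjectured `2K` law, pre-registered by the cell's desk (lead g21, R2132 (K2),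
words «2K LAW ON AP SUPPORTS»): a pure DEGREE COUNT, with no positivity and no symmetry hypothesis at all.

* `coeff_det_eq_zero_of_apWindow` — if every exponent of a `2 × 2` pencil `∑ₗ X^{εₗ} • Mₗ` (pivot and letters alike, ANY
  real `2 × 2` matrices) lies in the window `{e₀ + j·δ : j ≤ L}`, then the coefficient of `Xⁿ` in its determinant vanishes
  unless `n = 2e₀ + j·δ` with `j ≤ 2L`;
* `card_posRoots_det_le_of_apWindow` — hence the determinant has at most `2L + 1` monomials and, by Descartes' rule of signs
  (tree: `Census.card_posRoots_le_signVariations`, `signVariations_lt_card_support`), at most `2L` distinct positive zeros;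
* `pivotPosRoots_le_of_apWindow` — the same in the `pivotPosRoots` currency: `pivotPosRoots e d J P ≤ 2 * L`;
* `pivotPosRoots_le_two_mul_of_apSupport` — the AP-SUPPORT SECTOR of the `2K` law: if the `K + 1` exponents `e, d₀, …, d_{K−1}`
  lie in an arithmetic progression of `K + 1` terms (in particular if they ARE one), then `Z₊ ≤ 2K`, for every pivot `J` and
  every letters — so on this sector the conjectured row `PivotRootLawAt 2 K q (2K)` holds with room to spare (no use of `Pₖ ⪰ 0`).

Why this is only a sector: for a general two-sided support the determinant has up to `1 + K + K(K+1)/2` distinct degrees and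
Descartes allows `2K + 2` sign variations (R1₂ is sharp as a SIGN count); the AP window collapses the pair sums `dₖ + dₗ` onto
`2K + 1` degrees.  Nothing here bears on `MatrixDescartes` in its window, on `DoorA26` / `DoorA34`, on the cell's registers,
or on `VP ≠ VNP`.

[folklore] Descartes' rule of signs (Mathlib `Polynomial.roots_countP_pos_le_signVariations`); no single source.
-/

-- `Summit.ValiantsHypothesis.ValiantsHypothesis.…` repeats a component by the D-0017 layout
-- (single-conjunct summit), which the `dupNamespace` linter flags; the name is mandated.
set_option linter.dupNamespace false

namespace Summit.ValiantsHypothesis.ValiantsHypothesis.Theorems.LacunarySymmetroidMatrixDescartes.Pivot.APSupport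

open Polynomial Matrix Finset
open scoped BigOperators
open Summit.ValiantsHypothesis.ValiantsHypothesis.Theorems.LacunarySymmetroidMatrixDescartes.Pivot.TwoDescartes
  (letter expo agg pencil_eq_sum coeff_det agg_eq_zero)

variable {K : ℕ}

/-- **Degree support on an AP window.**  If every exponent of the re-indexed `2 × 2` pencil lies in `{e₀ + j·δ : j ≤ L}`,
the coefficient of `Xⁿ` in its determinant vanishes unless `n = 2e₀ + j·δ` for some `j ≤ 2L` (the determinant's degrees are
sums of two exponents; `J` and the `Pₖ` are arbitrary real `2 × 2` matrices). [folklore] -/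
theorem coeff_det_eq_zero_of_apWindow (e : ℕ) (d : Fin K → ℕ) (J : Matrix (Fin 2) (Fin 2) ℝ)
    (P : Fin K → Matrix (Fin 2) (Fin 2) ℝ) (e₀ δ L : ℕ) (hwin : ∀ l, ∃ j, j ≤ L ∧ expo e d l = e₀ + j * δ) (n : ℕ)
    (hn : ∀ j, j ≤ 2 * L → n ≠ 2 * e₀ + j * δ) :
    (Matrix.det (∑ l, ((X : ℝ[X]) ^ expo e d l) • (letter J P l).map Polynomial.C)).coeff n = 0 := by
  rw [coeff_det]
  refine Finset.sum_eq_zero fun x hx => ?_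
  obtain ⟨a, b⟩ := x
  replace hx : a + b = n := by simpa using hx
  -- either no letter sits at degree `a`, or none at degree `b`: otherwise `n = a + b` is in the doubled window
  by_cases ha : ∃ l, expo e d l = a
  · by_cases hb : ∃ l, expo e d l = b
    · exfalso
      obtain ⟨la, hla⟩ := ha
      obtain ⟨lb, hlb⟩ := hb
      obtain ⟨ja, hja, hja'⟩ := hwin la
      obtain ⟨jb, hjb, hjb'⟩ := hwin lb
      refine hn (ja + jb) (by omega) ?_
      rw [← hx, ← hla, ← hlb, hja', hjb']
      ring
    · push Not at hb
      simp only [agg_eq_zero e d J P b hb, Matrix.zero_apply, mul_zero, sub_self]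
  · push Not at ha
    simp only [agg_eq_zero e d J P a ha, Matrix.zero_apply, zero_mul, sub_self]

/-- **At most `2L` positive zeros on an AP window of `L + 1` terms.**  For ANY real `2 × 2` matrices `J, Pₖ` and exponents
`e, dₖ` all of the form `e₀ + j·δ` with `j ≤ L`, the determinant of `X^e • J + ∑ₖ X^{dₖ} • Pₖ` has at most `2L + 1` monomials,
hence at most `2L` distinct positive zeros (Descartes). [folklore] -/
theorem card_posRoots_det_le_of_apWindow (e : ℕ) (d : Fin K → ℕ) (J : Matrix (Fin 2) (Fin 2) ℝ)
    (P : Fin K → Matrix (Fin 2) (Fin 2) ℝ) (e₀ δ L : ℕ) (he : ∃ j, j ≤ L ∧ e = e₀ + j * δ)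
    (hd : ∀ k, ∃ j, j ≤ L ∧ d k = e₀ + j * δ) :
    ((Matrix.det (((X : ℝ[X]) ^ e) • J.map Polynomial.C
        + ∑ k, ((X : ℝ[X]) ^ d k) • (P k).map Polynomial.C)).roots.toFinset.filter (fun t => 0 < t)).card
      ≤ 2 * L := by
  classical
  rw [pencil_eq_sum]
  set f := Matrix.det (∑ l, ((X : ℝ[X]) ^ expo e d l) • (letter J P l).map Polynomial.C) with hf
  have hwin : ∀ l, ∃ j, j ≤ L ∧ expo e d l = e₀ + j * δ := by
    rintro (_ | k)
    · exact he
    · exact hd k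
  -- the support of `f` lies in the doubled window
  have hsupp : f.support ⊆ (Finset.range (2 * L + 1)).image (fun j => 2 * e₀ + j * δ) := by
    intro n hn
    rw [Polynomial.mem_support_iff] at hn
    by_contra hnot
    refine hn (coeff_det_eq_zero_of_apWindow e d J P e₀ δ L hwin n fun j hj hnj => hnot ?_)
    exact Finset.mem_image.mpr ⟨j, Finset.mem_range.mpr (by omega), hnj.symm⟩
  have hcard : f.support.card ≤ 2 * L + 1 := by
    refine (Finset.card_le_card hsupp).trans ((Finset.card_image_le).trans ?_)
    rw [Finset.card_range]
  by_cases hf0 : f = 0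
  · rw [hf0]; simp
  have h1 := Census.card_posRoots_le_signVariations f
  have h2 := Literature.Computability.AlgebraicComplexity.signVariations_lt_card_support hf0
  omega

/-- The AP-window bound in the `pivotPosRoots` currency: exponents in `{e₀ + j·δ : j ≤ L}` ⇒ `pivotPosRoots e d J P ≤ 2L`
(any real `2 × 2` pivot `J` and letters `Pₖ`). [folklore] -/
theorem pivotPosRoots_le_of_apWindow (e : ℕ) (d : Fin K → ℕ) (J : Matrix (Fin 2) (Fin 2) ℝ)
    (P : Fin K → Matrix (Fin 2) (Fin 2) ℝ) (e₀ δ L : ℕ) (he : ∃ j, j ≤ L ∧ e = e₀ + j * δ)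
    (hd : ∀ k, ∃ j, j ≤ L ∧ d k = e₀ + j * δ) :
    pivotPosRoots e d J P ≤ 2 * L :=
  card_posRoots_det_le_of_apWindow e d J P e₀ δ L he hd

/-- **The AP-SUPPORT SECTOR of the `2K` law at `m = 2`.**  If the `K + 1` exponents `e, d₀, …, d_{K−1}` of a `2 × 2` pivot
pencil all lie in an arithmetic progression `e₀, e₀ + δ, …, e₀ + K·δ` of `K + 1` terms (in particular if, sorted, they ARE an
arithmetic progression), then `Z₊ ≤ 2K` — for EVERY real pivot `J` and EVERY real letters `Pₖ`, with no semidefiniteness used.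
On this sector the conjectured row `PivotRootLawAt 2 K q (2K)` therefore holds (desk R2132 (K2)). [folklore] -/
theorem pivotPosRoots_le_two_mul_of_apSupport (e : ℕ) (d : Fin K → ℕ) (J : Matrix (Fin 2) (Fin 2) ℝ)
    (P : Fin K → Matrix (Fin 2) (Fin 2) ℝ) (e₀ δ : ℕ) (he : ∃ j, j ≤ K ∧ e = e₀ + j * δ)
    (hd : ∀ k, ∃ j, j ≤ K ∧ d k = e₀ + j * δ) :
    pivotPosRoots e d J P ≤ 2 * K :=
  pivotPosRoots_le_of_apWindow e d J P e₀ δ K he hd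

/-- Consecutive-exponent instance: if `e = e₀ + j₀` and `dₖ = e₀ + jₖ` with all `j ≤ K` (unit step `δ = 1`, i.e. the exponents
lie among `K + 1` CONSECUTIVE integers), then `Z₊ ≤ 2K`. [folklore] -/
theorem pivotPosRoots_le_two_mul_of_consecutive (e : ℕ) (d : Fin K → ℕ) (J : Matrix (Fin 2) (Fin 2) ℝ)
    (P : Fin K → Matrix (Fin 2) (Fin 2) ℝ) (e₀ : ℕ) (he : e₀ ≤ e ∧ e ≤ e₀ + K) (hd : ∀ k, e₀ ≤ d k ∧ d k ≤ e₀ + K) :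
    pivotPosRoots e d J P ≤ 2 * K := by
  refine pivotPosRoots_le_two_mul_of_apSupport e d J P e₀ 1 ⟨e - e₀, by omega, by omega⟩ fun k => ?_
  obtain ⟨h1, h2⟩ := hd k
  exact ⟨d k - e₀, by omega, by omega⟩

end Summit.ValiantsHypothesis.ValiantsHypothesis.Theorems.LacunarySymmetroidMatrixDescartes.Pivot.APSupport
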